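import Summits.NavierStokesRegularity.TurbBounds.Results.P2R4
import Summits.NavierStokesRegularity.TurbBounds.TailP2R4GlueN12
import Summits.NavierStokesRegularity.TurbBounds.TailP2R4GlueN16
import Summits.NavierStokesRegularity.TurbBounds.LayerDensity
import HarnessLib

/-!
# Row P2-R4 (Theorem 1's row): the Legendre TAIL LEMMA `Results.P2R4.TailLemma` PROVED (both element types), and the headline bound from ONE named hypothesis
(cell `pub-turb` / `turb-bounds`; v2 — discharges the second named hypothesis of the Results chain for the HEADLINE row P2-R4;
written by pub-turb-cert, prover-pub-turb-cert-g6-0, 2026-08-22.)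

HONEST FRAMING: rigorous bounds for the stated PDE and boundary conditions; no claim about physical turbulence beyond the bound.
KERNEL-CHECKED here (standard axioms, no `sorry`, no `native_decide`): `tailLemma : Results.P2R4.TailLemma` — for each element type
(N = 12, dim 45; N = 16, dim 53), every real `K > 0` and rational `ε > 0`: `MelR ε (1/K) K ⪰ 0` + the two scalar tail slacks ⇒ the layer
form SPEC-P2 (1.1) of the member `(3/2, 697/4, η′₈)` is `≥ 0` on the one-sided `C² × C¹` class. Ingredients: `TailPolyGen` (generic
(N, P) lower bound, rbsdp SPEC 3.5–3.7), `P2R4Profile` (`g = Σ_{p≤8} ĝ_p P_p`), the generated bridges `TailP2R4GlueN12/N16` (literal rule =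
tracked finite part: sixteen structured piece identities per type, kernel-certified triple-product tables, profile modes), `LayerDensity`
(Weierstrass). CONSEQUENCE: `nusselt_bound_of_layerReduction` — THEOREM 1's bound `Nu ≤ (4323705766579/144644500000000)·√Ra − 1/2`
for every `Ra ≥ 485809/4`, from the SINGLE hypothesis `LayerReduction Nu` (the cited background-layer reduction).
NOT CLAIMED: a formal proof of the Boussinesq/Navier–Stokes reduction (`LayerReduction` stays a named hypothesis); nothing about physical turbulence.
-/

set_option linter.style.longLine false

noncomputable section

namespace Summit.NavierStokesRegularity.TurbBounds.TailP2R4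

open Polynomial intervalIntegral MeasureTheory Finset Matrix Set
open Summit.NavierStokesRegularity.TurbBounds.LayerForm
open Summit.NavierStokesRegularity.TurbBounds.LadderTail (w IsLadder phi lam w_pos lam_pos)
open Summit.NavierStokesRegularity.TurbBounds.LegendreCoeffs
open Summit.NavierStokesRegularity.TurbBounds.CouplingSplit (pairWeight couplingExact)
open Summit.NavierStokesRegularity.TurbBounds.TailPolyGen (finGen layerForm_poly_lower_bound)
open Summit.NavierStokesRegularity.TurbBounds.Certs.P2R4.Evaluator (s T)

/-- The Legendre data of the profile polynomial are the literal `ĝ`. -/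
theorem legCoeff_gp (p : ℕ) : legCoeff gp p = if p ≤ 8 then ghatR p else 0 := by
  unfold gp; exact legCoeff_expansion 8 ghatR p

/-- pair weights with `ĉ(gp)` are those with the literal `ĝ` -/
theorem pairWeight_gp (n m : ℕ) : pairWeight 8 (legCoeff gp) n m = pairWeight 8 ghatR n m := by
  unfold pairWeight
  refine sum_congr rfl fun p hp => ?_
  rw [legCoeff_gp, if_pos (by rw [Finset.mem_range] at hp; omega)]

/-- exact coupling with `ĉ(gp)` is the one with the literal `ĝ` -/
theorem couplingExact_gp (N : ℕ) (b e : ℕ → ℝ) : couplingExact N 8 (legCoeff gp) b e = couplingExact N 8 ghatR b e := by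
  unfold couplingExact; simp_rw [pairWeight_gp]

/-- Hence the tracked finite part with `ĉ(gp)` is the one with the literal `ĝ`. -/
theorem finGen_gp (N : ℕ) (s' u v ε' T' : ℝ) (c a b d e : ℕ → ℝ) :
    finGen N 8 s' u v ε' T' (legCoeff gp) c a b d e = finGen N 8 s' u v ε' T' ghatR c a b d e := by
  unfold finGen; rw [couplingExact_gp]

/-- `|g| ≤ T` on `[-1, 1]` for the profile polynomial (the tree's `Results.P2R4.g_abs_le`, `T = 294803817/160000`). -/
theorem gp_abs_le : ∀ x ∈ Icc (-1 : ℝ) 1, |gp.eval x| ≤ ((T : ℚ) : ℝ) := by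
  intro x hx
  rw [gp_eval x]
  have h := Results.P2R4.g_abs_le x hx
  have e : ((T : ℚ) : ℝ) = (294803817 : ℝ) / 160000 := by norm_num [T]
  rw [e]; exact h

/-- **N12 element (dim 45): positivity of the P2-R4 layer form on polynomial test fields** given the element LMI and its two slacks. -/
theorem layerForm_poly_nonneg_N12 {K : ℝ} (hK : 0 < K) {ε : ℚ} (hε : 0 < ε)
    (hM : (Certs.P2R4.Evaluator.N12.MelR ε (1 / K) K).PosSemidef)
    (hW : 0 ≤ 16 * (1 / K) * ((s : ℝ) - 1) - (T : ℝ) * (ε : ℝ) * (Certs.P2R4.Evaluator.N12.lamW : ℝ))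
    (hT : 0 ≤ 4 * s - T * Certs.P2R4.Evaluator.N12.lamT / ε)
    (Vp Θp : ℝ[X]) (hV0 : Vp.eval (-1) = 0) (hV1 : (derivative Vp).eval (-1) = 0) (hΘ0 : Θp.eval (-1) = 0) :
    0 ≤ layerForm ((3 : ℝ) / 2) ((697 : ℝ) / 4) Results.P2R4.eta K (fun x => Vp.eval x) (fun x => Θp.eval x) := by
  have hεR : (0 : ℝ) < (ε : ℝ) := by exact_mod_cast hε
  have hs32 : (1 : ℝ) ≤ (3 : ℝ) / 2 := by norm_num
  have hlb := layerForm_poly_lower_bound 12 8 gp natDegree_gp_le (fun x => (gp_eval x).symm) gp_abs_le hs32 hK hεR Vp Θp hV0 hV1 hΘ0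
  rw [finGen_gp] at hlb
  set V1 := derivative Vp with hV1def
  set V2 := derivative V1 with hV2def
  set Θ1 := derivative Θp with hΘ1def
  set c := legCoeff V2 with hc
  set a := legCoeff V1 with ha
  set b := legCoeff Vp with hb
  set d := legCoeff Θ1 with hd
  set e := legCoeff Θp with he
  have hA : IsLadder c a := by rw [hc, ha, hV2def]; exact isLadder_legCoeff V1 hV1
  have hB : IsLadder a b := by rw [ha, hb, hV1def]; exact isLadder_legCoeff Vp hV0
  have hE : IsLadder d e := by rw [hd, he, hΘ1def]; exact isLadder_legCoeff Θp hΘ0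
  have ha0 : a 0 = c 0 - c 1 / 3 := by rw [ha, hc, hV2def]; exact legCoeff_zero_of_wall V1 hV1
  have hb0 : b 0 = a 0 - a 1 / 3 := by rw [hb, ha, hV1def]; exact legCoeff_zero_of_wall Vp hV0
  have he0 : e 0 = d 0 - d 1 / 3 := by rw [he, hd, hΘ1def]; exact legCoeff_zero_of_wall Θp hΘ0
  clear_value c a b d e
  have key := N12.finGen_eq_quadForm hA hB hE ha0 hb0 he0 ε (1 / K) K
  have hs' : ((s : ℚ) : ℝ) = (3 : ℝ) / 2 := by norm_num [s]
  rw [hs'] at key hW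
  have h0 : 0 ≤ N12.stack c d ⬝ᵥ (Certs.P2R4.Evaluator.N12.MelR ε (1 / K) K *ᵥ N12.stack c d) := by
    have h := hM.dotProduct_mulVec_nonneg (N12.stack c d)
    rwa [star_trivial] at h
  have hRc0 : 0 ≤ ∑ k ∈ range (max Vp.natDegree Θp.natDegree + 2), w (12 + 8 + 3 + k) * c (12 + 8 + 3 + k) ^ 2 :=
    sum_nonneg fun k _ => mul_nonneg (w_pos _).le (sq_nonneg _)
  have hRd0 : 0 ≤ ∑ k ∈ range (max Vp.natDegree Θp.natDegree + 2), w (12 + 8 + 2 + k) * d (12 + 8 + 2 + k) ^ 2 :=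
    sum_nonneg fun k _ => mul_nonneg (w_pos _).le (sq_nonneg _)
  have hlamW : (Certs.P2R4.Evaluator.N12.lamW : ℝ) = lam (12 + 8) * lam (12 + 8 + 1) := by
    norm_num [Certs.P2R4.Evaluator.N12.lamW, lam]
  have hlamT : (Certs.P2R4.Evaluator.N12.lamT : ℝ) = lam (12 + 8) := by norm_num [Certs.P2R4.Evaluator.N12.lamT, lam]
  have hW' : 0 ≤ (16 * (1 / K) * ((3 : ℝ) / 2 - 1) - (T : ℝ) * (ε : ℝ) * (lam (12 + 8) * lam (12 + 8 + 1)))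
      * ∑ k ∈ range (max Vp.natDegree Θp.natDegree + 2), w (12 + 8 + 3 + k) * c (12 + 8 + 3 + k) ^ 2 := by
    rw [← hlamW]; exact mul_nonneg hW hRc0
  have hT' : 0 ≤ (4 * ((3 : ℝ) / 2) - (T : ℝ) * lam (12 + 8) / (ε : ℝ))
      * ∑ k ∈ range (max Vp.natDegree Θp.natDegree + 2), w (12 + 8 + 2 + k) * d (12 + 8 + 2 + k) ^ 2 := by
    refine mul_nonneg ?_ hRd0
    have h : (0 : ℝ) ≤ 4 * (s : ℝ) - (T : ℝ) * (Certs.P2R4.Evaluator.N12.lamT : ℝ) / (ε : ℝ) := by exact_mod_cast hT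
    rwa [hlamT, hs'] at h
  linarith [hlb, key, h0, hW', hT']

/-- **N16 element (dim 53): positivity of the P2-R4 layer form on polynomial test fields** given the element LMI and its two slacks. -/
theorem layerForm_poly_nonneg_N16 {K : ℝ} (hK : 0 < K) {ε : ℚ} (hε : 0 < ε)
    (hM : (Certs.P2R4.Evaluator.N16.MelR ε (1 / K) K).PosSemidef)
    (hW : 0 ≤ 16 * (1 / K) * ((s : ℝ) - 1) - (T : ℝ) * (ε : ℝ) * (Certs.P2R4.Evaluator.N16.lamW : ℝ))
    (hT : 0 ≤ 4 * s - T * Certs.P2R4.Evaluator.N16.lamT / ε)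
    (Vp Θp : ℝ[X]) (hV0 : Vp.eval (-1) = 0) (hV1 : (derivative Vp).eval (-1) = 0) (hΘ0 : Θp.eval (-1) = 0) :
    0 ≤ layerForm ((3 : ℝ) / 2) ((697 : ℝ) / 4) Results.P2R4.eta K (fun x => Vp.eval x) (fun x => Θp.eval x) := by
  have hεR : (0 : ℝ) < (ε : ℝ) := by exact_mod_cast hε
  have hs32 : (1 : ℝ) ≤ (3 : ℝ) / 2 := by norm_num
  have hlb := layerForm_poly_lower_bound 16 8 gp natDegree_gp_le (fun x => (gp_eval x).symm) gp_abs_le hs32 hK hεR Vp Θp hV0 hV1 hΘ0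
  rw [finGen_gp] at hlb
  set V1 := derivative Vp with hV1def
  set V2 := derivative V1 with hV2def
  set Θ1 := derivative Θp with hΘ1def
  set c := legCoeff V2 with hc
  set a := legCoeff V1 with ha
  set b := legCoeff Vp with hb
  set d := legCoeff Θ1 with hd
  set e := legCoeff Θp with he
  have hA : IsLadder c a := by rw [hc, ha, hV2def]; exact isLadder_legCoeff V1 hV1
  have hB : IsLadder a b := by rw [ha, hb, hV1def]; exact isLadder_legCoeff Vp hV0
  have hE : IsLadder d e := by rw [hd, he, hΘ1def]; exact isLadder_legCoeff Θp hΘ0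
  have ha0 : a 0 = c 0 - c 1 / 3 := by rw [ha, hc, hV2def]; exact legCoeff_zero_of_wall V1 hV1
  have hb0 : b 0 = a 0 - a 1 / 3 := by rw [hb, ha, hV1def]; exact legCoeff_zero_of_wall Vp hV0
  have he0 : e 0 = d 0 - d 1 / 3 := by rw [he, hd, hΘ1def]; exact legCoeff_zero_of_wall Θp hΘ0
  clear_value c a b d e
  have key := N16.finGen_eq_quadForm hA hB hE ha0 hb0 he0 ε (1 / K) K
  have hs' : ((s : ℚ) : ℝ) = (3 : ℝ) / 2 := by norm_num [s]
  rw [hs'] at key hW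
  have h0 : 0 ≤ N16.stack c d ⬝ᵥ (Certs.P2R4.Evaluator.N16.MelR ε (1 / K) K *ᵥ N16.stack c d) := by
    have h := hM.dotProduct_mulVec_nonneg (N16.stack c d)
    rwa [star_trivial] at h
  have hRc0 : 0 ≤ ∑ k ∈ range (max Vp.natDegree Θp.natDegree + 2), w (16 + 8 + 3 + k) * c (16 + 8 + 3 + k) ^ 2 :=
    sum_nonneg fun k _ => mul_nonneg (w_pos _).le (sq_nonneg _)
  have hRd0 : 0 ≤ ∑ k ∈ range (max Vp.natDegree Θp.natDegree + 2), w (16 + 8 + 2 + k) * d (16 + 8 + 2 + k) ^ 2 :=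
    sum_nonneg fun k _ => mul_nonneg (w_pos _).le (sq_nonneg _)
  have hlamW : (Certs.P2R4.Evaluator.N16.lamW : ℝ) = lam (16 + 8) * lam (16 + 8 + 1) := by
    norm_num [Certs.P2R4.Evaluator.N16.lamW, lam]
  have hlamT : (Certs.P2R4.Evaluator.N16.lamT : ℝ) = lam (16 + 8) := by norm_num [Certs.P2R4.Evaluator.N16.lamT, lam]
  have hW' : 0 ≤ (16 * (1 / K) * ((3 : ℝ) / 2 - 1) - (T : ℝ) * (ε : ℝ) * (lam (16 + 8) * lam (16 + 8 + 1)))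
      * ∑ k ∈ range (max Vp.natDegree Θp.natDegree + 2), w (16 + 8 + 3 + k) * c (16 + 8 + 3 + k) ^ 2 := by
    rw [← hlamW]; exact mul_nonneg hW hRc0
  have hT' : 0 ≤ (4 * ((3 : ℝ) / 2) - (T : ℝ) * lam (16 + 8) / (ε : ℝ))
      * ∑ k ∈ range (max Vp.natDegree Θp.natDegree + 2), w (16 + 8 + 2 + k) * d (16 + 8 + 2 + k) ^ 2 := by
    refine mul_nonneg ?_ hRd0
    have h : (0 : ℝ) ≤ 4 * (s : ℝ) - (T : ℝ) * (Certs.P2R4.Evaluator.N16.lamT : ℝ) / (ε : ℝ) := by exact_mod_cast hT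
    rwa [hlamT, hs'] at h
  linarith [hlb, key, h0, hW', hT']

/-- **The tail lemma R-T / R-P2d for the literal P2-R4 element rules (both truncation groups), PROVED** (was the named hypothesis
`Results.P2R4.TailLemma` of Theorem 1's row). -/
abbrev Goal : Prop := Results.P2R4.TailLemma

/-- `tailLemma : Goal` (= `Results.P2R4.TailLemma`; reducible row-specific alias — gen 7 dedup fix per pub-turb-sos DEDUP-PREFLIGHT, see `P2R3Tail`). -/
theorem tailLemma : Goal :=
  ⟨fun _ hK _ hε hM hW hT _ _ hVΘ => LayerDensity.layerForm_nonneg_of_poly Results.P2R4.eta_continuous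
      (fun Vp Θp h0 h1 h2 => layerForm_poly_nonneg_N12 hK hε hM hW hT Vp Θp h0 h1 h2) hVΘ,
   fun _ hK _ hε hM hW hT _ _ hVΘ => LayerDensity.layerForm_nonneg_of_poly Results.P2R4.eta_continuous
      (fun Vp Θp h0 h1 h2 => layerForm_poly_nonneg_N16 hK hε hM hW hT Vp Θp h0 h1 h2) hVΘ⟩

/-- (★) for the member `(3/2, 697/4, η′₈)`, now unconditional. -/
theorem layer_positivity_holds : LayerPositivity ((3 : ℝ) / 2) ((697 : ℝ) / 4) Results.P2R4.eta :=
  Results.P2R4.layer_positivity tailLemma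

/-- **THEOREM 1 (row P2-R4) from ONE named hypothesis.** For every quantity `Nu` obeying the background-method layer reduction
(`LayerReduction`, cited + refereed): `Nu(Ra) ≤ (4323705766579/144644500000000)·Ra^{1/2} − 1/2` for every `Ra ≥ 485809/4 = 121452.25`.
The tail lemma, the finite certificate (119 LMIs on the continuum `0 < K ≤ 8511/4` with the interval evaluator), the cutoff, the profile
bound and the cover are ALL kernel-checked in the tree. -/
theorem nusselt_bound_of_layerReduction (Nu : ℝ → ℝ) (hRed : LayerReduction Nu) :
    ∀ Ra : ℝ, ((485809 : ℝ) / 4) ≤ Ra → Nu Ra ≤ ((4323705766579 : ℝ) / 144644500000000) * Real.sqrt Ra - 1 / 2 :=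
  Results.P2R4.nusselt_bound Nu hRed tailLemma

/-- Printed form of Theorem 1 from ONE named hypothesis: `Nu(Ra) ≤ 0.029892·Ra^{1/2} − 1/2` for every `Ra ≥ 485809/4`. -/
theorem nusselt_bound_decimal_of_layerReduction (Nu : ℝ → ℝ) (hRed : LayerReduction Nu) :
    ∀ Ra : ℝ, ((485809 : ℝ) / 4) ≤ Ra → Nu Ra ≤ ((7473 : ℝ) / 250000) * Real.sqrt Ra - 1 / 2 :=
  Results.P2R4.nusselt_bound_decimal Nu hRed tailLemma

end Summit.NavierStokesRegularity.TurbBounds.TailP2R4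

end
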